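import Literature.AlgebraicGeometry.Motives.QuadraticFormHessian
import Mathlib.Algebra.MvPolynomial.Funext
import Mathlib.Algebra.MvPolynomial.PDeriv
import HarnessLib

/-!
# The singular radical of a quadratic form splits off, in every characteristic

Topic `Literature/AlgebraicGeometry/Motives`; THEOREMS ONLY (no definition, no instance, no named fact).  Companion of
`Motives/QuadraticFormHessian` (the Hessian rows `hessian F` of a quadratic form, `∂F/∂xⱼ(v) = (M v)ⱼ`) and of the
characteristic-`≠ 2` normal forms `Motives/SplitQuadricNormalForm`, `Motives/QuadricNormalForm`.  Here NOTHING is assumed on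
the characteristic of the field `k`:

* `eval_smul_eq_pow_mul_eval` — `φ(t • z) = tᵉ φ(z)` for a form `φ` of degree `e` (any commutative semiring);
* `eval_add_eq_of_isHomogeneous_two` — the **polar identity** `F(v + w) = F(v) + F(w) + Σⱼ vⱼ ∂ⱼF(w)` for a quadratic
  form `F` over any commutative semiring (both sides are linear in `F`; on a monomial `xᵢxⱼ` it is
  `(vᵢ+wᵢ)(vⱼ+wⱼ) = vᵢvⱼ + wᵢwⱼ + (vᵢwⱼ + vⱼwᵢ)`), i.e. the polar bilinear form of `F` is `b_F(v, w) = v ⬝ (M w)` with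
  `M = hessian F` — valid also in characteristic `2`, where Euler's identity `2F(v) = vᵀ M v` is empty;
* ★ `exists_linearSubst_eq_rename_of_isHomogeneous_two` — **splitting off the singular radical.**  For a quadratic form
  `F(x₀, …, x_N)` over an infinite field `k` let `S = {s | F(s) = 0, M s = 0} ⊆ k^{N+1}` (the singular locus of the affine
  cone `F = 0`; a linear subspace in every characteristic — in characteristic `2` it may be strictly smaller than
  `ker M = rad b_F`).  Then `F` is invariant under translation by `S`, and in coordinates adapted to a decomposition
  `k^{N+1} = W ⊕ S` (`dim W = a`, `dim S = c`) the form becomes a form `G` in the first `a` variables only,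
  `σ_τ F = G(x₀, …, x_{a-1})`, whose affine cone has NO singular point other than the origin
  (`G(u) = 0 ∧ ∀ j, ∂ⱼG(u) = 0 → u = 0`).  This is the characteristic-free replacement of «a quadric is a cone over a
  nonsingular quadric» (Hartshorne I Ex. 5.12 (c),(d) assumes `char k ≠ 2`); in the language of
  Elman–Karpenko–Merkurjev, *The Algebraic and Geometric Theory of Quadratic Forms* (2008), §7, `S = rad F` (the
  «quadratic radical», contained in the radical of the polar form) and `G` is the regular part `F|_W`.

The substitution is packaged as in `Motives/LinesGenerateChowOneLinear.exists_linearSubst_of_basis`: linear forms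
`τⱼ` with an inverse substitution `τ'` (`σ_τ ∘ σ_{τ'} = id = σ_{τ'} ∘ σ_τ`), and `G` is embedded by `rename` along
`Fin a → Fin (a + c) = Fin (N + 1)`, `l ↦ l` (`Fin.castAdd`).  Infinite `k` is used only to compare polynomials by their
values (`MvPolynomial.funext`).

What is NOT here: the classification of the regular part `G` (split forms; over a non-closed field this is arithmetic),
and primality / irreducibility questions (`Motives/QuadraticFormsSmallRank`).

## References

* R. Elman, N. Karpenko, A. Merkurjev, *The Algebraic and Geometric Theory of Quadratic Forms*, AMS Colloquium Publ. 56
  (2008), §7 (quadratic forms and their radicals in arbitrary characteristic). [ElmanKarpenkoMerkurjev2008]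
* R. Hartshorne, *Algebraic Geometry*, GTM 52 (1977), I Ex. 5.12. [Hartshorne1977]

## Provenance

Cell `pub/decomp-res` (summit `ResolutionOfSingularities`, route `EquisingularLift`, residual «blow-up models of quadrics in
all characteristics»), seat `leafhand-res-equisingularlift-6` g3 (prover), 2026-08-31.  AI-produced, weaker than expert review.
-/

noncomputable section

open CategoryTheory AlgebraicGeometry Order

universe u

namespace Literature.AlgebraicGeometry.Motives

namespace ProjectiveSpaceCells

open _root_.MvPolynomial Matrix

/-! ### Scaling and the polar identity (any commutative semiring) -/

section Polar

variable {σ : Type*} {R : Type*} [CommSemiring R]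

/-- An exponent vector of degree `2` is `eᵢ + eⱼ` (possibly `i = j`).  Twin of
`Literature.Combinatorics.LorentzianPolynomials.exists_eq_single_add_single_of_degree_eq_two`, kept private here to avoid the
import. [folklore] -/
private theorem exists_eq_single_add_single_of_degree_eq_two (d : σ →₀ ℕ) (hd : d.degree = 2) :
    ∃ i j, d = Finsupp.single i 1 + Finsupp.single j 1 := by
  classical
  have hcard : (Finsupp.toMultiset d).card = 2 := by
    rw [Finsupp.card_toMultiset, ← hd]
    rfl
  obtain ⟨x, y, hxy⟩ := Multiset.card_eq_two.mp hcard
  refine ⟨x, y, Multiset.toFinsupp.symm.injective ?_⟩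
  change Finsupp.toMultiset _ = Finsupp.toMultiset _
  rw [hxy, map_add, Finsupp.toMultiset_single, Finsupp.toMultiset_single, one_nsmul, one_nsmul,
    Multiset.singleton_add, Multiset.insert_eq_cons]

/-- **Scaling**: `φ(t • z) = tᵉ · φ(z)` for a form `φ` of degree `e` (every monomial has degree `e`) — Hartshorne I §2:
«`f(λa₀, …, λa_n) = λᵈ f(a₀, …, a_n)`». [cite: Hartshorne1977, I §2 (p. 9, homogeneous polynomials)] -/
theorem eval_smul_eq_pow_mul_eval {φ : MvPolynomial σ R} {e : ℕ}
    (hφ : φ.IsHomogeneous e) (t : R) (z : σ → R) :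
    eval (t • z) φ = t ^ e * eval z φ := by
  classical
  conv_lhs => rw [← φ.support_sum_monomial_coeff]
  conv_rhs => rw [← φ.support_sum_monomial_coeff]
  rw [map_sum, map_sum, Finset.mul_sum]
  refine Finset.sum_congr rfl fun m hm => ?_
  have hdeg : (m.sum fun _ k => k) = e := by
    have := hφ (mem_support_iff.1 hm)
    simpa only [Finsupp.weight_apply, Pi.one_apply, smul_eq_mul, mul_one] using this
  rw [eval_monomial, eval_monomial, Finsupp.prod, Finsupp.prod]
  simp only [Pi.smul_apply, smul_eq_mul, mul_pow, Finset.prod_mul_distrib,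
    Finset.prod_pow_eq_pow_sum]
  rw [show (∑ i ∈ m.support, m i) = e from hdeg]
  ring

/-- **The polar identity of a quadratic form, in every characteristic**: `F(v + w) = F(v) + F(w) + Σⱼ vⱼ (∂ⱼF)(w)`.
Both sides are `R`-linear in `F`, and `F` lies in the span of the monomials `xᵢxⱼ` of degree `2`, for which it reads
`(vᵢ+wᵢ)(vⱼ+wⱼ) = vᵢvⱼ + wᵢwⱼ + (vᵢwⱼ + vⱼwᵢ)`.  This is the polar form `b_φ(v, w) = φ(v + w) − φ(v) − φ(w)` of a
quadratic form (Elman–Karpenko–Merkurjev §7, definition of a quadratic form and of its polar form), computed as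
`Σⱼ vⱼ ∂ⱼφ(w)`. [cite: ElmanKarpenkoMerkurjev2008, §7 (polar form of a quadratic form)] -/
theorem eval_add_eq_of_isHomogeneous_two [Fintype σ] {F : MvPolynomial σ R} (hF : F.IsHomogeneous 2)
    (v w : σ → R) :
    eval (v + w) F = eval v F + eval w F + ∑ j, v j * eval w (pderiv j F) := by
  classical
  -- both sides are `R`-linear in `F`
  let f : MvPolynomial σ R →ₗ[R] R := (aeval (v + w)).toLinearMap
  let g : MvPolynomial σ R →ₗ[R] R := (aeval v).toLinearMap + (aeval w).toLinearMap +
    ∑ j, v j • ((aeval w).toLinearMap ∘ₗ (pderiv j).toLinearMap)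
  have hf : ∀ p, f p = eval (v + w) p := fun p => by simp [f]
  have hg : ∀ p, g p = eval v p + eval w p + ∑ j, v j * eval w (pderiv j p) := fun p => by
    simp [g, LinearMap.sum_apply]
  rw [← hf, ← hg]
  have hmem : F ∈ Submodule.span R ((fun m => AddMonoidAlgebra.single m (1 : R)) '' {d : σ →₀ ℕ | d.degree = 2}) := by
    rw [← AddMonoidAlgebra.supported_eq_span_single, ← homogeneousSubmodule_eq_finsupp_supported]
    exact hF
  refine LinearMap.eqOn_span ?_ hmem
  rintro _ ⟨d, hd, rfl⟩
  obtain ⟨i, j, rfl⟩ := exists_eq_single_add_single_of_degree_eq_two d hd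
  have hX : (AddMonoidAlgebra.single (Finsupp.single i 1 + Finsupp.single j 1) (1 : R) : MvPolynomial σ R) = X i * X j := by
    rw [single_eq_monomial, X, X, monomial_mul, mul_one]
  beta_reduce
  rw [hX, hf, hg]
  have hder : ∀ l, eval w (pderiv l (X i * X j : MvPolynomial σ R)) =
      (if i = l then w j else 0) + (if j = l then w i else 0) := fun l => by
    rw [Derivation.leibniz, pderiv_X, pderiv_X, smul_eq_mul, smul_eq_mul, map_add, map_mul, map_mul, eval_X, eval_X]
    simp only [Pi.single_apply, apply_ite (eval w), map_one, map_zero]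
    split_ifs <;> ring
  simp only [map_mul, eval_X, Pi.add_apply, hder, mul_add, Finset.sum_add_distrib, mul_ite, mul_zero,
    Finset.sum_ite_eq, Finset.mem_univ, if_true]
  ring

end Polar

/-! ### Splitting off the singular radical -/

section Radical

variable {k : Type u} [Field k] {N : ℕ}

/-- Coordinates of a combination: `(Σⱼ vⱼ bⱼ)ᵢ = (j ↦ (bⱼ)ᵢ) ⬝ v`. [folklore] -/
private theorem sum_smul_apply_eq_dotProduct (b : Fin (N + 1) → Fin (N + 1) → k) (v : Fin (N + 1) → k)
    (i : Fin (N + 1)) : (∑ j, v j • b j) i = (fun j => b j i) ⬝ᵥ v := by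
  simp [Finset.sum_apply, dotProduct, mul_comm]

/-- ★ **Splitting off the singular radical of a quadratic form (every characteristic).**  For a quadratic form
`F(x₀, …, x_N)` over an infinite field there are mutually inverse invertible linear substitutions `τ, τ'`, a splitting
`N + 1 = a + c` and a quadratic form `G` in the first `a` variables with `σ_τ F = G(x₀, …, x_{a-1})` (as `rename` along
`Fin.castAdd c`) such that the affine cone of `G` has no singular point besides the origin:
`G(u) = 0 → (∀ j, ∂ⱼG(u) = 0) → u = 0`.  Proof: `S = {F = 0} ∩ ker (hessian F)` is a subspace by the polar identity,
`F(v + s) = F(v)` for `s ∈ S`; take a complement `W`, an adapted basis, and `G = F|_W`; a singular vector `u` of the cone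
of `G` gives `Σ uₗ wₗ ∈ S ∩ W = 0`.  Elman–Karpenko–Merkurjev §7: `S = rad φ` is the quadratic radical and
`φ ≅ φ|_{rad φ} ⊥ φ|_W` with `φ|_W` regular for any complement `W`; Hartshorne I Ex. 5.12 (d) is the case `char k ≠ 2`.
[cite: ElmanKarpenkoMerkurjev2008, §7 (quadratic radical `rad φ`; regular part)] -/
theorem exists_linearSubst_eq_rename_of_isHomogeneous_two [Infinite k] {F : MvPolynomial (Fin (N + 1)) k}
    (hF : F.IsHomogeneous 2) :
    ∃ (a c : ℕ) (hac : a + c = N + 1) (τ τ' : Fin (N + 1) → MvPolynomial (Fin (N + 1)) k)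
      (G : MvPolynomial (Fin a) k),
      (∀ j, (τ j).IsHomogeneous 1) ∧ (∀ j, (τ' j).IsHomogeneous 1) ∧
        (∀ p, aeval τ (aeval τ' p) = p) ∧ (∀ p, aeval τ' (aeval τ p) = p) ∧
          G.IsHomogeneous 2 ∧ aeval τ F = rename (fun l : Fin a => Fin.cast hac (Fin.castAdd c l)) G ∧
            ∀ u : Fin a → k, eval u G = 0 → (∀ j, eval u (pderiv j G) = 0) → u = 0 := by
  classical
  -- polar identity and the Hessian
  have hpolar : ∀ v w : Fin (N + 1) → k,
      eval (v + w) F = eval v F + eval w F + ∑ j, v j * (hessian F *ᵥ w) j := fun v w => by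
    rw [eval_add_eq_of_isHomogeneous_two hF v w]
    simp only [eval_pderiv_eq hF]
  -- the singular radical `S = {F = 0} ∩ ker M`
  let S : Submodule k (Fin (N + 1) → k) :=
    { carrier := {s | eval s F = 0 ∧ hessian F *ᵥ s = 0}
      add_mem' := by
        rintro s t ⟨hs, hMs⟩ ⟨ht, hMt⟩
        refine ⟨?_, by rw [Matrix.mulVec_add, hMs, hMt, add_zero]⟩
        rw [hpolar, hs, ht, hMt]
        simp
      zero_mem' := by
        refine ⟨?_, Matrix.mulVec_zero _⟩
        have h := eval_smul_eq_pow_mul_eval hF 0 0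
        rwa [zero_smul, zero_pow two_ne_zero, zero_mul] at h
      smul_mem' := by
        rintro c s ⟨hs, hMs⟩
        refine ⟨?_, by rw [Matrix.mulVec_smul, hMs, smul_zero]⟩
        rw [eval_smul_eq_pow_mul_eval hF, hs, mul_zero] }
  have hSF : ∀ s ∈ S, eval s F = 0 := fun s hs => hs.1
  have hSM : ∀ s ∈ S, hessian F *ᵥ s = 0 := fun s hs => hs.2
  have htrans : ∀ s ∈ S, ∀ v, eval (v + s) F = eval v F := fun s hs v => by
    rw [hpolar, hSF s hs, hSM s hs]; simp
  -- a complement `W` of `S` and adapted bases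
  obtain ⟨W, hSW⟩ := S.exists_isCompl
  have hWS : IsCompl W S := hSW.symm
  set a := Module.finrank k W with ha
  set c := Module.finrank k S with hc
  have hac : a + c = N + 1 := by
    rw [ha, hc, Submodule.finrank_add_eq_of_isCompl hWS, Module.finrank_fin_fun]
  let bW := Module.finBasisOfFinrankEq k W ha.symm
  let bS := Module.finBasisOfFinrankEq k S hc.symm
  let E : Fin a ⊕ Fin c ≃ Fin (N + 1) := finSumFinEquiv.trans (finCongr hac)
  let bV : Module.Basis (Fin (N + 1)) k (Fin (N + 1) → k) :=
    ((bW.prod bS).map (Submodule.prodEquivOfIsCompl W S hWS)).reindex E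
  have hbV_inl : ∀ l, bV (E (Sum.inl l)) = (bW l : Fin (N + 1) → k) := fun l => by
    simp [bV, Module.Basis.reindex_apply, Module.Basis.map_apply, Module.Basis.prod_apply]
  have hbV_inr : ∀ l, bV (E (Sum.inr l)) = (bS l : Fin (N + 1) → k) := fun l => by
    simp [bV, Module.Basis.reindex_apply, Module.Basis.map_apply, Module.Basis.prod_apply]
  -- the transposed family (columns of the matrix whose rows are the `bV j`) is again a basis
  let A : Matrix (Fin (N + 1)) (Fin (N + 1)) k := Matrix.of fun j i => bV j i
  have hrows : LinearIndependent k A.row := bV.linearIndependent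
  have hcols : LinearIndependent k A.col :=
    Matrix.linearIndependent_cols_iff_isUnit.mpr (Matrix.linearIndependent_rows_iff_isUnit.mp hrows)
  let bT := basisOfLinearIndependentOfCardEqFinrank hcols (by simp)
  have hbT : ∀ i, bT i = fun j => bV j i := fun i => by
    rw [coe_basisOfLinearIndependentOfCardEqFinrank]; rfl
  obtain ⟨τ', hτ, hτ', hinv, hinv', -⟩ := exists_linearSubst_of_basis bT
  -- the combination map `v ↦ Σⱼ vⱼ bⱼ` and its evaluation property
  have heval : ∀ v : Fin (N + 1) → k, eval v (aeval (fun i => lin (bT i)) F) = eval (∑ j, v j • bV j) F := by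
    intro v
    rw [MvPolynomial.aeval_eq_bind₁, show eval v (bind₁ (fun i => lin (bT i)) F) =
      eval (fun i => eval v (lin (bT i))) F from eval₂Hom_bind₁ _ _ _ _]
    have hfun : (fun i => eval v (lin (bT i))) = ∑ j, v j • bV j := by
      funext i
      rw [eval_lin, hbT, sum_smul_apply_eq_dotProduct]
    rw [hfun]
  -- decomposition of `Σⱼ vⱼ bⱼ` into its `W`- and `S`-parts
  let ι : Fin a → Fin (N + 1) := fun l => Fin.cast hac (Fin.castAdd c l)
  have hιE : ∀ l, E (Sum.inl l) = ι l := fun l => rfl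
  let xW : (Fin a → k) → (Fin (N + 1) → k) := fun u => ∑ l, u l • (bW l : Fin (N + 1) → k)
  have hdecomp : ∀ v : Fin (N + 1) → k,
      ∑ j, v j • bV j = xW (fun l => v (ι l)) + ∑ l, v (E (Sum.inr l)) • (bS l : Fin (N + 1) → k) := by
    intro v
    rw [← Equiv.sum_comp E, Fintype.sum_sum_type]
    simp only [hbV_inl, hbV_inr]
    rfl
  have hSpart : ∀ v : Fin (N + 1) → k, ∑ l, v (E (Sum.inr l)) • (bS l : Fin (N + 1) → k) ∈ S := fun v =>
    S.sum_mem fun l _ => S.smul_mem _ (bS l).2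
  -- the residual form `G` on `W ≅ k^a`
  let wsub : Fin (N + 1) → MvPolynomial (Fin a) k := fun i => ∑ l : Fin a, C ((bW l : Fin (N + 1) → k) i) * X l
  let G : MvPolynomial (Fin a) k := aeval wsub F
  have hGeval : ∀ u : Fin a → k, eval u G = eval (xW u) F := by
    intro u
    show eval u (aeval wsub F) = _
    rw [MvPolynomial.aeval_eq_bind₁, show eval u (bind₁ wsub F) = eval (fun i => eval u (wsub i)) F from
      eval₂Hom_bind₁ _ _ _ _]
    have hfun : (fun i => eval u (wsub i)) = xW u := by
      funext i
      simp [xW, wsub, map_sum, Finset.sum_apply, mul_comm]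
    rw [hfun]
  have hGhom : G.IsHomogeneous 2 := by
    have h := hF.aeval wsub (fun i => IsHomogeneous.sum _ _ _ fun l _ => isHomogeneous_C_mul_X _ _)
    rwa [one_mul] at h
  -- the key identity `σ_τ F = G(x_ι)`
  have hkey : aeval (fun i => lin (bT i)) F = rename ι G := by
    refine MvPolynomial.funext fun v => ?_
    rw [heval, eval_rename, hGeval, hdecomp v, htrans _ (hSpart v)]
    rfl
  -- polar identity for `G`, transported from `F`
  have hxW_add : ∀ u u' : Fin a → k, xW (u + u') = xW u + xW u' := fun u u' => by
    simp only [xW, Pi.add_apply, add_smul, Finset.sum_add_distrib]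
  have hxW_mem : ∀ u, xW u ∈ W := fun u => W.sum_mem fun l _ => W.smul_mem _ (bW l).2
  have hGpolar : ∀ u u' : Fin a → k,
      eval (u' + u) G = eval u' G + eval u G + ∑ j, u' j * eval u (pderiv j G) :=
    fun u u' => eval_add_eq_of_isHomogeneous_two hGhom u' u
  -- nonsingularity of `G`: a common zero `u` of `G` and its partials gives `xW u ∈ S ∩ W = 0`
  have hns : ∀ u : Fin a → k, eval u G = 0 → (∀ j, eval u (pderiv j G) = 0) → u = 0 := by
    intro u hGu hdGu
    -- translation invariance of `G` by `u`, hence of `F` by `xW u` on `W`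
    have hGtrans : ∀ u', eval (u' + u) G = eval u' G := fun u' => by
      rw [hGpolar, hGu]; simp [hdGu]
    have hFtransW : ∀ u', eval (xW u' + xW u) F = eval (xW u') F := fun u' => by
      rw [← hxW_add, ← hGeval, ← hGeval, hGtrans]
    -- hence of `F` by `xW u` everywhere (decompose along `W ⊕ S`)
    have hFtrans : ∀ z : Fin (N + 1) → k, eval (z + xW u) F = eval z F := by
      intro z
      obtain ⟨y, hy, s, hs, rfl⟩ := Submodule.mem_sup.mp (show z ∈ W ⊔ S by rw [hWS.sup_eq_top]; trivial)
      -- `y ∈ W` is a combination of the `bW l`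
      have hy' : y = xW (fun l => bW.repr ⟨y, hy⟩ l) := by
        have h := congrArg (fun w : W => (w : Fin (N + 1) → k)) (bW.sum_repr ⟨y, hy⟩)
        simp only [Submodule.coe_sum, Submodule.coe_smul] at h
        exact h.symm
      rw [add_right_comm, htrans s hs, htrans s hs, hy', hFtransW]
    -- so `xW u ∈ S`
    have hmemS : xW u ∈ S := by
      refine ⟨by simpa using hGu ▸ (hGeval u).symm, ?_⟩
      funext i
      have h := hpolar (Pi.single i 1) (xW u)
      rw [hFtrans, add_assoc, left_eq_add] at h
      have h0 : eval (xW u) F = 0 := (hGeval u) ▸ hGu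
      rw [h0, zero_add] at h
      simpa [Pi.single_apply] using h
    -- and `xW u ∈ W`, so `xW u = 0`, so `u = 0`
    have hzero : xW u = 0 := by
      have h := hWS.disjoint
      rw [Submodule.disjoint_def] at h
      exact h _ (hxW_mem u) hmemS
    have hli := bW.linearIndependent
    rw [Fintype.linearIndependent_iff] at hli
    funext l
    refine hli u ?_ l
    apply Subtype.ext
    simpa [xW, Submodule.coe_sum] using hzero
  exact ⟨a, c, hac, fun i => lin (bT i), τ', G, hτ, hτ', hinv, hinv', hGhom, hkey, hns⟩
end Radical

end ProjectiveSpaceCells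

end Literature.AlgebraicGeometry.Motives

end
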